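/-
Copyright (c) 2026 the pub-hodgecm-mathlib formalisation cell (harness21).  Prover seat hodgecm-mathlib-R90-C10-p05 (g2), R90-TF SLAB section S1 «Ch10-local» (base
R90-C10), h413 = `stmt-HodgeConjecture-24833`; line «B_pos» (U4Keys :182 in BRANCH B at positive depth, memo `R90/R90-C10-p05/g2/DESIGN-Bpos-inert.md` §5 (B-1), RULING R-S1-12
(1)∕un-cross 23:40:20Z of the S1 chair R90-C10-plan (g2)): brick (B-1′), CM half — «THE NORMALISED `(J_e, θ)`-TYPE BASIS `(f₁, f_w)` OF `i(χ₁, 1)` ON `U(Φ₃)(L⁺_v)` IN BRANCH B»,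
the two-depth twin of ★ `K2E3BranchBTypeBasisCM` (K2E3-p32 (g0), Iwahori, depth zero).  2026-09-05.
-/
import Summits.HodgeConjecture.HodgeConjecture.Theorems.K2E3BranchBTypeBasisCM            -- ★ (K2E3-p32 (g0)): the d0B twin; brings ★ `theta_eq_tau_of_mem`, ★ `theta_eq_tau_weylConj_of_mem`, ★ `isUnit_apply_zero_zero_of_mem`, ★ `map_weyl_eq_weylLongU`, ★ `disj_borel_I`, ★ `not_mem_mul_of_disj_fin_two`
import Summits.HodgeConjecture.HodgeConjecture.Theorems.K2E3IwahoriTwoDepthLettersCM      -- ★ p862547 (K2E3-p14 (g9)): the letters `(e, Jg, hJg, Je, hJe)`, `isOpen_coe_of_forall_mem_iff`, `le_inf_conj_of_forall_mem_iff`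
import Summits.HodgeConjecture.HodgeConjecture.Theorems.R90S1BposTypeBasisCells            -- ★ p863221 (this seat): `exists_normalised_typeBasis_of_cells` (cover-free MACKEY)
import Summits.HodgeConjecture.HodgeConjecture.Theorems.K2E3BranchAIrreducibleTwoDepth    -- ★ (K2E3-p34 (g2)): `levelGroup_le_iwahori` (`J_e ≤ I`, reused — not restated)
import HarnessLib

/-!
# R90-TF S1 «Ch10-local» ∕ K2 E3 «U4Keys» :182, BRANCH B AT POSITIVE DEPTH — brick (B-1′), CM: THE NORMALISED `(J_e, θ)`-TYPE BASIS `(f₁, f_w)` OF `i(χ₁, 1)` ON `U(Φ₃)(L⁺_v)`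
# «BRANCH B (`χ₁(u·σu) = 1` on units) + `θ` a character of the two-depth group `J_e` ⟹ ∃ f₁ f_w ∈ i(χ₁,1), `(J_e, θ)`-eigen, `f₁(1) = 1, f₁(w₀) = 0, f_w(1) = 0, f_w(w₀) = 1`»
# [Roche1998 §3–§4; Keys1984 §7 Thm (2); Casselman1995 §6.3; BernsteinZelevinsky1977 §2.3]

Cell `pub/hodgecm-mathlib`, crux H413 = `stmt-HodgeConjecture-24833`, route of record `HCCMUnconditional` (no route verbs); R90-TF section S1 (junction socket A2′ = U4Keys :217,
REL over :155 and :182).  THEOREMS ONLY (no `def`, no `instance`, no `notation`, no named-fact hypothesis, no `sorry`); lane `--supports stmt-HodgeConjecture-24833 --as helper`,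
count-neutral.  NOT THE PAYER of :182.  FRAME = the (G3) frame of the d0B files `(L v) (w hw) (eA heA) (ϖ hϖ) (g₁ hg₁) (K0 K1 I hK0 hK1 hI) (w₀ hw₀)` + the two-depth letters of ★
p862547 `(r₁ s₁ r₂ s₂) (Jg hJg) (Je hJe)` with the N̄-side exponents positive (`1 ≤ r₂`, `1 ≤ s₂`, so that `J_e ≤ I`).

THE POINT (memo §2 (E7), §5 (B-1)).  The d0B file ★ `K2E3BranchBTypeBasisCM.exists_normalised_typeBasis_of_depthZero_of_normChar_eq_one` instantiates ★ MACKEY over the TWO cells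
`P·I ⊔ P·w₀·I`; at the two-depth level group `J_e` there are infinitely many `(P, J_e)`-cells, so this file instantiates the COVER-FREE Mackey ★-pending
`R90S1BposTypeBasisCells.exists_normalised_typeBasis_of_cells` instead.  Letters discharged here: `J_e` OPEN (★ p862547 `isOpen_coe_of_forall_mem_iff` pulled back along `eA`),
`J_e ≤ I` (★ p862547 `le_inf_conj_of_forall_mem_iff` + the comap letters `hK0 hK1 hI hJe`), `θ 1 = 1`, `w₀ ∉ P·J_e` (⟸ `w₀ ∉ P·I`, ★ `disj_borel_I`), `θ = τ` on `J_e ∩ P` (★ Z2A-3c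
`theta_eq_tau_of_mem` read on `J_e ≤ I`), `θ(s) = τ(w₀ s w₀⁻¹)` on `J_e ∩ w₀⁻¹Pw₀` (★ `theta_eq_tau_weylConj_of_mem`, the ONE use of `hB`, read on `J_e ≤ I`).  Letters KEPT
hypothesis-first (they are exactly the θ-letters of K2E3-p34 (g2)'s two-depth type vector (A) and are discharged ONCE, in the leaf): `hθmul` (θ multiplicative on `J_e`: ★ p862709
`theta_mul_concave` ∕ ★ p862455 from `hcond`, `hcondF`) and the smoothness letter `(C, hCo, hθC)` (an open subgroup on which `θ = 1`: the principal congruence subgroup of level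
`cond χ₁`, from `hcond`).
* **`exists_normalised_typeBasis_twoDepth_of_normChar_eq_one`** — the normalised `(J_e, θ)`-type basis `(f₁, f_w)` of `i(χ₁, 1)` in Branch B.
HONEST LABEL.  HC_CM is proved only modulo the 7 printed citations (2 remaining named inputs: hLiu418 = `stmt-HodgeConjecture-24832`, h413 = `stmt-HodgeConjecture-24833`) until rung 0
closes; count-neutral — this file does NOT pay :182 or A2′; no printed citation is discharged.

## References
* [Roche1998] A. Roche, Ann. Sci. ÉNS (4) 31 (1998), §3–§4 (`|W_χ| = 2`: the two-dimensional Hecke module of the type at `J_χ`).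
* [Keys1984] D. Keys, Compositio Math. 51 (1984), §3, §7 Theorem (2) p. 126.
* [Casselman1995] W. Casselman, *Introduction to the theory of admissible representations of `p`-adic reductive groups* (1995), §6.3.
* [BernsteinZelevinsky1977] I. N. Bernstein, A. V. Zelevinsky, Ann. Sci. ÉNS 10 (1977), §2.3.
-/

set_option autoImplicit false
-- the mandated namespace has the single-problem summit's repeated segment (`HodgeConjecture.HodgeConjecture`)
set_option linter.dupNamespace false

noncomputable section

open NumberField IsDedekindDomain
open scoped Matrix MatrixGroups WithZero Valued
open Literature.NumberTheory Literature.NumberTheory.Automorphic Literature.NumberTheory.Automorphic.UnitaryGroup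
open Literature.NumberTheory.Rogawski1990

namespace Summit.HodgeConjecture.HodgeConjecture.R90.S1.BposBranchBTypeBasisTwoDepthCM

open Summit.HodgeConjecture.HodgeConjecture.Cruxes.H413
open Summit.HodgeConjecture.HodgeConjecture.Cruxes.H413.K2E3DepthZeroIwahoriCharacterCM
open Summit.HodgeConjecture.HodgeConjecture.Cruxes.H413.K2E3BranchATorusWitnessCM
open Summit.HodgeConjecture.HodgeConjecture.Cruxes.H413.K2E3BranchATypeLettersCM

variable (L : Type) [Field L] [NumberField L] [IsCMField L] (v : HeightOneSpectrum (𝓞 ↥(maximalRealSubfield L)))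
  (w : PlacesOver L v) (hw : IsCMField.complexConj L • w.1 = w.1)
  (eA : Gqs L v ≃ₜ* ↥(unitaryGroupOfForm (galAdicCompletionMap (L := L) (IsCMField.complexConj L) hw) ((StdForm.antidiagonal 3).over (w.1.adicCompletion L))))
  (heA : ∀ g : Gqs L v,
    ((eA g : ↥(unitaryGroupOfForm (galAdicCompletionMap (L := L) (IsCMField.complexConj L) hw) ((StdForm.antidiagonal 3).over (w.1.adicCompletion L)))) :
        GL (Fin 3) (w.1.adicCompletion L)) =
      ((localNonsplitEquiv (IsCMField.complexConj L) (qsForm L) (IsCMField.complexConj_ne_one L) w hw g :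
        ↥(unitaryGroupOfForm (galAdicCompletionMap (L := L) (IsCMField.complexConj L) hw) (placeForm (qsForm L) w.1))) : GL (Fin 3) (w.1.adicCompletion L)))
  {ϖ : w.1.adicCompletion L} (hϖ : Valued.v ϖ = WithZero.exp (-1 : ℤ))
  (g₁ : GL (Fin 3) (w.1.adicCompletion L)) (hg₁ : (g₁ : Matrix (Fin 3) (Fin 3) (w.1.adicCompletion L)) = Matrix.diagonal ![(1 : w.1.adicCompletion L), 1, ϖ])
  (K0 K1 I : Subgroup (Gqs L v))
  (hK0 : K0 = ((glInt 3 (w.1.adicCompletion L)).subgroupOf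
    (unitaryGroupOfForm (galAdicCompletionMap (L := L) (IsCMField.complexConj L) hw) ((StdForm.antidiagonal 3).over (w.1.adicCompletion L)))).comap
      eA.toMulEquiv.toMonoidHom)
  (hK1 : K1 = (((glInt 3 (w.1.adicCompletion L)).map (MulAut.conj g₁).toMonoidHom).subgroupOf
    (unitaryGroupOfForm (galAdicCompletionMap (L := L) (IsCMField.complexConj L) hw) ((StdForm.antidiagonal 3).over (w.1.adicCompletion L)))).comap
      eA.toMulEquiv.toMonoidHom)
  (hI : I = K0 ⊓ K1)
  (r₁ s₁ r₂ s₂ : ℕ) (Jg : Subgroup ↥(unitaryGroupOfForm (galAdicCompletionMap (L := L) (IsCMField.complexConj L) hw) ((StdForm.antidiagonal 3).over (w.1.adicCompletion L))))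
  (hJg : ∀ k : ↥(unitaryGroupOfForm (galAdicCompletionMap (L := L) (IsCMField.complexConj L) hw) ((StdForm.antidiagonal 3).over (w.1.adicCompletion L))),
    k ∈ Jg ↔ ∀ i j, Valued.v (((k : GL (Fin 3) (w.1.adicCompletion L)) : Matrix (Fin 3) (Fin 3) (w.1.adicCompletion L)) i j) ≤
      Valued.v ϖ ^ (![![0, r₁, s₁], ![r₂, 0, r₁], ![s₂, r₂, 0]] : Fin 3 → Fin 3 → ℕ) i j)
  (Je : Subgroup (Gqs L v)) (hJe : Je = Jg.comap eA.toMulEquiv.toMonoidHom)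
  (w₀ : Gqs L v) (hw₀ : Units.val (w₀.val : GL (Fin 3) (LocalRing L v)) = cmLocalForm L 3 v)

/-! ## §1 `J_e` is open (`J_e ≤ I` is ★ `K2E3BranchAIrreducibleTwoDepth.levelGroup_le_iwahori`) -/

include hϖ hJg hJe in
/-- **`J_e` is OPEN in `U(Φ₃)(L⁺_v)`** (the model group `Jg` is open ★ p862547, `eA` is continuous, `Je = eA⁻¹ Jg`). [cite: BruhatTits1972, (6.4.9)] [cite: Tits1979, §3.2] -/
theorem isOpen_levelGroup : IsOpen (Je : Set (Gqs L v)) := by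
  subst hJe
  have h := (K2E3IwahoriTwoDepthLettersCM.isOpen_coe_of_forall_mem_iff (galAdicCompletionMap (L := L) (IsCMField.complexConj L) hw) hϖ _ Jg hJg).preimage eA.continuous
  exact h

/-! ## §2 The normalised `(J_e, θ)`-type basis of `i(χ₁, 1)` in Branch B -/

open Classical in
include hw heA hϖ hg₁ hK0 hK1 hI hJg hJe hw₀ in
set_option maxHeartbeats 8000000 in
set_option synthInstance.maxHeartbeats 400000 in
-- the `SmoothInd` carrier of `cmPrincipalSeries` with the `dif`-character on `Gqs L v` read in two definitionally equal carriers (class of ★ `K2E3BranchBTypeBasisCM`)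
/-- **THE NORMALISED `(J_e, θ)`-TYPE BASIS `(f₁, f_w)` OF `i(χ₁, 1)` ON `U(Φ₃)(L⁺_v)`, BRANCH B, TWO-DEPTH LEVEL.**  `v` non-split; `χ₁ : (L ⊗ L⁺_v)ˣ → ℂˣ` with `χ₁(u·σu) = 1` for every
unit `u` with `|u_{w′}| = 1` (`hB`: BRANCH B, `w₀ ∈ W_χ`); the two-depth group `J_e`, `e = (r₁, s₁; r₂, s₂)` with `1 ≤ r₂`, `1 ≤ s₂`; `θ(g) = χ₁(g₀₀)` (the `dif`-spelling) assumed
MULTIPLICATIVE on `J_e` (`hθmul`, ★ p862709 ∕ p862455 from the conductor letters) and TRIVIAL on an open subgroup `C` (`hCo`, `hθC`: the principal congruence subgroup of the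
conductor level); `w₀` the element of matrix `Φ₃`.  Then there are sections `f₁, f_w` of `i(χ₁, 1) = Ind_P^G ((χ₁,1)∘proj ⊗ δ^{1∕2})` with `b·f = θ(b)·f` for `b ∈ J_e` and
`f₁(1) = 1, f₁(w₀) = 0, f_w(1) = 0, f_w(w₀) = 1` — ★-pending cover-free MACKEY `exists_normalised_typeBasis_of_cells` with §1 (`J_e` open, `J_e ≤ I`), `w₀ ∉ P·I` (★ `disj_borel_I`),
★ `theta_eq_tau_of_mem`, ★ `theta_eq_tau_weylConj_of_mem` (`hB`). [cite: Roche1998, §3–§4] [cite: Keys1984, §7 Theorem (2) p. 126] [cite: Casselman1995, §6.3]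
[cite: BernsteinZelevinsky1977, §2.3] -/
theorem exists_normalised_typeBasis_twoDepth_of_normChar_eq_one (h10 : 1 ≤ r₂) (h20 : 1 ≤ s₂) (χ₁ : (LocalRing L v)ˣ →* ℂˣ)
    (hB : ∀ u : (LocalRing L v)ˣ, (∀ w' : PlacesOver L v, Valued.v ((u : LocalRing L v) w') = 1) →
      χ₁ (u * Units.map (conjLocal L (IsCMField.complexConj L) v : LocalRing L v →* LocalRing L v) u) = 1)
    (hθmul : ∀ x ∈ Je, ∀ y ∈ Je,
      (if h : IsUnit ((((x * y : Gqs L v).val : GL (Fin 3) (LocalRing L v)) : Matrix (Fin 3) (Fin 3) (LocalRing L v)) 0 0) then ((χ₁ h.unit : ℂˣ) : ℂ) else 0) =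
        (if h : IsUnit (((x.val : GL (Fin 3) (LocalRing L v)) : Matrix (Fin 3) (Fin 3) (LocalRing L v)) 0 0) then ((χ₁ h.unit : ℂˣ) : ℂ) else 0) *
          (if h : IsUnit (((y.val : GL (Fin 3) (LocalRing L v)) : Matrix (Fin 3) (Fin 3) (LocalRing L v)) 0 0) then ((χ₁ h.unit : ℂˣ) : ℂ) else 0))
    (C : Subgroup (Gqs L v)) (hCo : IsOpen (C : Set (Gqs L v)))
    (hθC : ∀ c ∈ C, (if h : IsUnit (((c.val : GL (Fin 3) (LocalRing L v)) : Matrix (Fin 3) (Fin 3) (LocalRing L v)) 0 0) then ((χ₁ h.unit : ℂˣ) : ℂ) else 0) = 1) :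
    haveI := locallyCompactSpace_cmBorelU L 3 v
    ∃ f₁ f_w : Representation.SmoothInd (cmBorelTriple L 3 v).P
        (Representation.twist (((Representation.trivial ℂ ↥(torusU (conjLocal L (IsCMField.complexConj L) v) (cmLocalForm L 3 v)) ℂ).twist
          (cmTorusCharPair L v χ₁ 1)).comp (cmBorelTriple L 3 v).proj) (rootDeltaChar (cmBorelTriple L 3 v).P)),
      (∀ x ∈ Je, Representation.smoothIndRep _ _ x f₁ =
        (if h : IsUnit (((x.val : GL (Fin 3) (LocalRing L v)) : Matrix (Fin 3) (Fin 3) (LocalRing L v)) 0 0) then ((χ₁ h.unit : ℂˣ) : ℂ) else 0) • f₁) ∧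
      (∀ x ∈ Je, Representation.smoothIndRep _ _ x f_w =
        (if h : IsUnit (((x.val : GL (Fin 3) (LocalRing L v)) : Matrix (Fin 3) (Fin 3) (LocalRing L v)) 0 0) then ((χ₁ h.unit : ℂˣ) : ℂ) else 0) • f_w) ∧
      f₁.toFun 1 = 1 ∧ f₁.toFun (w₀ : ↥(unitaryGroupOfForm (conjLocal L (IsCMField.complexConj L) v) (cmLocalForm L 3 v))) = 0 ∧
      f_w.toFun 1 = 0 ∧ f_w.toFun (w₀ : ↥(unitaryGroupOfForm (conjLocal L (IsCMField.complexConj L) v) (cmLocalForm L 3 v))) = 1 := by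
  haveI := locallyCompactSpace_cmBorelU L 3 v
  -- the structural instances of the carrier, synthesised once (class of ★ `K2E3BranchBTypeBasisCM`)
  haveI hTG : IsTopologicalGroup ↥(unitaryGroupOfForm (conjLocal L (IsCMField.complexConj L) v) (cmLocalForm L 3 v)) := inferInstance
  have hJo := isOpen_levelGroup L v w hw eA hϖ r₁ s₁ r₂ s₂ Jg hJg Je hJe
  have hJeI : Je ≤ I := K2E3BranchAIrreducibleTwoDepth.levelGroup_le_iwahori L v w hw eA hϖ g₁ hg₁ K0 K1 I hK0 hK1 hI r₁ s₁ r₂ s₂ Jg hJg Je hJe h10 h20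
  -- `θ 1 = 1`
  have h1unit : IsUnit ((((1 : Gqs L v).val : GL (Fin 3) (LocalRing L v)) : Matrix (Fin 3) (Fin 3) (LocalRing L v)) 0 0) :=
    isUnit_apply_zero_zero_of_mem L v w hw eA heA hϖ g₁ hg₁ K0 K1 I hK0 hK1 hI I.one_mem
  have hθone : (if h : IsUnit ((((1 : Gqs L v).val : GL (Fin 3) (LocalRing L v)) : Matrix (Fin 3) (Fin 3) (LocalRing L v)) 0 0) then ((χ₁ h.unit : ℂˣ) : ℂ) else 0) = 1 := by
    rw [dif_pos h1unit]
    have hu : h1unit.unit = 1 := Units.ext (by rw [IsUnit.unit_spec]; rfl)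
    rw [hu, map_one, Units.val_one]
  -- `w₀ ∉ P·J_e` (⟸ `w₀ ∉ P·I`, the Bruhat–Iwahori disjointness with `w̃ = eA⁻¹(w) = w₀`)
  have hwtilde : eA.symm (weylLongU (galAdicCompletionMap (L := L) (IsCMField.complexConj L) hw) (rfl : (StdForm.antidiagonal 3).over (w.1.adicCompletion L) = _)) = w₀ := by
    rw [← map_weyl_eq_weylLongU L v w hw eA heA w₀ hw₀, ContinuousMulEquiv.symm_apply_apply]
  have hdisj' := F0P3cStCharTSStLevelsPF.disj_borel_I L v w hw eA heA hϖ g₁ hg₁ K0 K1 I hK0 hK1 hI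
  rw [hwtilde] at hdisj'
  have hwI := @K2E3IwahoriTypeBasisMackey.not_mem_mul_of_disj_fin_two _ _ (cmBorelTriple L 3 v).P I
    (w₀ : ↥(unitaryGroupOfForm (conjLocal L (IsCMField.complexConj L) v) (cmLocalForm L 3 v))) hdisj'
  have hwJe : ¬ ∃ h ∈ (cmBorelTriple L 3 v).P, ∃ b : ↥(unitaryGroupOfForm (conjLocal L (IsCMField.complexConj L) v) (cmLocalForm L 3 v)),
      b ∈ Je ∧ (w₀ : ↥(unitaryGroupOfForm (conjLocal L (IsCMField.complexConj L) v) (cmLocalForm L 3 v))) = h * b := by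
    rintro ⟨h, hh, b, hb, he⟩
    exact hwI ⟨h, hh, b, hJeI hb, he⟩
  -- `@`-form: the carrier's instances are passed explicitly so that the openness facts (stated on `Gqs L v`) are accepted by definitional unfolding
  exact @BposTypeBasisCells.exists_normalised_typeBasis_of_cells _ _ _ hTG (cmBorelTriple L 3 v).P _ Je hJo
    (fun g : ↥(unitaryGroupOfForm (conjLocal L (IsCMField.complexConj L) v) (cmLocalForm L 3 v)) =>
      if h : IsUnit (((g : GL (Fin 3) (LocalRing L v)) : Matrix (Fin 3) (Fin 3) (LocalRing L v)) 0 0) then ((χ₁ h.unit : ℂˣ) : ℂ) else 0)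
    hθmul hθone C hCo hθC _ hwJe
    (fun s hsJ hsP => theta_eq_tau_of_mem L v w hw eA heA hϖ g₁ hg₁ K0 K1 I hK0 hK1 hI χ₁ s hsP (hJeI hsJ))
    (fun s hsJ hsP => K2E3BranchBTypeLettersCM.theta_eq_tau_weylConj_of_mem L v w hw eA heA hϖ g₁ hg₁ K0 K1 I hK0 hK1 hI w₀ hw₀ χ₁ hB s (hJeI hsJ) hsP)

end Summit.HodgeConjecture.HodgeConjecture.R90.S1.BposBranchBTypeBasisTwoDepthCM

end
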